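import Summits.ValiantsHypothesis.ValiantsHypothesis.Theorems.LangWeilTransferTameResolutionEliminantCoord
import Summits.ValiantsHypothesis.ValiantsHypothesis.Theorems.LangWeilTransferTameResolutionChoice
import Summits.ValiantsHypothesis.ValiantsHypothesis.Theorems.LangWeilTransferTameResolutionSizeCalculus
import Literature.RingTheory.Elimination.PerturbedCharpolyDegrees

/-!
# LangWeilTransfer, support item `TameResolution` (stmt-ValiantsHypothesis-6378) — a bounded-degree
# algebraic equation for one fibre coordinate over `ℤ[T̄]`

Route `LangWeilTransfer` of `ValiantsHypothesis` (conditional route; honest framing: bookkeeping,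
nothing here bears on VP ≠ VNP). Quantitative pass, step (C) of the roadmap note of val-lit-p6 g9:
the relations that drive the quantitative Noether loop. From `eliminant_identity_coord`, a small
natural specialisation `α ↦ a` of the combination coefficients (`exists_nat_le_eval_ne_zero`) and
the degree calculus `totalDegree_coeff_sLead_pertCharpoly_le`: every fibre coordinate `ξ_j`
satisfies `E(T̄, ξ_j) = 0` for some non-zero `E ∈ ℤ[T][U]` with `deg_U E ≤ (d+1)ⁿ` and
`T`-coefficients of total degree `≤ (d+1)ⁿ (1 + n d + 1)(d_T + 1)`.

* `exists_relation_coord`.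
-/

noncomputable section

open MvPolynomial
open Literature.RingTheory.Elimination

-- the summit and the problem share the name `ValiantsHypothesis` (D-0017 single-conjunct layout)
set_option linter.dupNamespace false

namespace Summit.ValiantsHypothesis.ValiantsHypothesis.Theorems.LangWeilTransfer

variable {F₀ : Type*} [Field F₀] {r n t d : ℕ}

/-- **A bounded-degree equation for a fibre coordinate.** In the setting of
`eliminant_identity_coord`, if the `T`-coefficients of the `S_k` have total degree `≤ d_T`, then for
every `j₀` there is `E ∈ ℤ[T][U]`, `E ≠ 0`, with `E(T̄, ξ_{j₀}) = 0`, `deg_U E ≤ (d+1)ⁿ` and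
coefficients of total degree `≤ (d+1)ⁿ · ((1 + n d + 1)(d_T + 1))`. -/
theorem exists_relation_coord
    (S : Fin t → MvPolynomial (Fin n) (MvPolynomial (Fin r) ℤ)) (hSd : ∀ k, (S k).totalDegree ≤ d)
    {dT : ℕ} (hST : ∀ k β, ((S k).coeff β).totalDegree ≤ dT)
    (φ : MvPolynomial (Fin n) (MvPolynomial (Fin r) ℤ) →+* F₀)
    (hT : Function.Injective (φ.comp MvPolynomial.C))
    (halg : ∀ j, ∃ P : Polynomial (MvPolynomial (Fin r) ℤ), P ≠ 0 ∧
      (P.map (φ.comp MvPolynomial.C)).eval (φ (X j)) = 0)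
    (hSφ : ∀ k, φ (S k) = 0)
    (hmin : ∀ 𝔮 : Ideal (MvPolynomial (Fin n) (MvPolynomial (Fin r) ℤ)), 𝔮.IsPrime →
      Ideal.span (Set.range S) ≤ 𝔮 → 𝔮 ≤ RingHom.ker φ → 𝔮 = RingHom.ker φ) (j₀ : Fin n) :
    ∃ E : Polynomial (MvPolynomial (Fin r) ℤ), E ≠ 0 ∧
      (E.map (φ.comp MvPolynomial.C)).eval (φ (X j₀)) = 0 ∧
      E.natDegree ≤ (d + 1) ^ n ∧
      ∀ i, (E.coeff i).totalDegree ≤ (d + 1) ^ n * (0 + (1 + n * d + 1) * (dT + 1)) := by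
  classical
  set θ := φ.comp MvPolynomial.C with hθ
  -- the universal single-coordinate eliminant
  let ι := Fin r ⊕ (Fin n × Fin t)
  let F : Fin n → MvPolynomial (Fin n) (MvPolynomial ι ℤ) := fun i =>
    ∑ k, C (X (Sum.inr (i, k))) *
      MvPolynomial.map (rename (Sum.inl : Fin r → ι) : MvPolynomial (Fin r) ℤ →ₐ[ℤ] MvPolynomial ι ℤ).toRingHom (S k)
  set 𝒬 := sLead (pertCharpoly (d + 1) F (X j₀) (1 + n * d + 1)) with h𝒬
  have h𝒬0 : 𝒬 ≠ 0 := sLead_ne_zero (pertCharpoly_ne_zero _ _ _ _)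
  have hid := eliminant_identity_coord S hSd φ hT halg hSφ hmin j₀
  simp only at hid
  -- sizes of `𝒬`
  have h𝒬deg : 𝒬.natDegree ≤ (d + 1) ^ n := natDegree_sLead_pertCharpoly_le (d + 1) F (X j₀) _
  have hF : ∀ i β, ((F i).coeff β).totalDegree ≤ dT + 1 := by
    intro i β
    have h : (F i).coeff β = ∑ k, X (Sum.inr (i, k)) * rename (Sum.inl : Fin r → ι) ((S k).coeff β) := by
      change coeff β (∑ k, _) = _
      rw [coeff_sum]
      refine Finset.sum_congr rfl fun k _ => ?_
      rw [coeff_C_mul, coeff_map]; rfl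
    rw [h]
    refine totalDegree_finsetSum_le fun k _ => ?_
    refine (totalDegree_mul _ _).trans ?_
    rw [totalDegree_X, add_comm]
    exact Nat.add_le_add_right ((totalDegree_rename_le _ _).trans (hST k β)) 1
  have hu : ∀ β, ((X j₀ : MvPolynomial (Fin n) (MvPolynomial ι ℤ)).coeff β).totalDegree ≤ 0 := by
    intro β
    rw [coeff_X]
    split_ifs
    · rw [totalDegree_one]
    · rw [totalDegree_zero]
  have h𝒬coeff : ∀ i, (𝒬.coeff i).totalDegree ≤ (d + 1) ^ n * (0 + (1 + n * d + 1) * (dT + 1)) :=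
    fun i => totalDegree_coeff_sLead_pertCharpoly_le F hF (X j₀) hu _ i
  -- choose the specialisation `α ↦ a`
  obtain ⟨k₀, hk₀⟩ : ∃ k, 𝒬.coeff k ≠ 0 := by
    by_contra h
    push Not at h
    exact h𝒬0 (Polynomial.ext fun k => by rw [h k, Polynomial.coeff_zero])
  let E₁ : MvPolynomial ι ℤ ≃ₐ[ℤ] MvPolynomial (Fin n × Fin t) (MvPolynomial (Fin r) ℤ) :=
    (renameEquiv ℤ (Equiv.sumComm (Fin r) (Fin n × Fin t))).trans (sumAlgEquiv ℤ (Fin n × Fin t) (Fin r))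
  set c₀ := E₁ (𝒬.coeff k₀) with hc₀
  have hc₀0 : c₀ ≠ 0 := by rw [hc₀]; exact (EmbeddingLike.map_ne_zero_iff).2 hk₀
  obtain ⟨a, -, ha⟩ := exists_nat_le_eval_ne_zero c₀ hc₀0 (fun i => degreeOf_le_totalDegree c₀ i)
  let σa : MvPolynomial ι ℤ →+* MvPolynomial (Fin r) ℤ :=
    eval₂Hom C (Sum.elim (fun k => X k) (fun p => C ((a p : ℕ) : ℤ)))
  have hσa : σa = (eval fun p => ((a p : ℕ) : MvPolynomial (Fin r) ℤ)).comp E₁.toRingEquiv.toRingHom := by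
    refine MvPolynomial.ringHom_ext (fun z => ?_) (fun v => ?_)
    · simp only [eq_intCast, map_intCast]
    · rcases v with k | p
      · simp only [σa, E₁, eval₂Hom_X', Sum.elim_inl, RingHom.comp_apply, RingEquiv.toRingHom_eq_coe,
          AlgEquiv.toRingEquiv_toRingHom, RingHom.coe_coe, AlgEquiv.trans_apply, renameEquiv_apply, rename_X,
          Equiv.sumComm_apply, Sum.swap_inl, sumAlgEquiv_X_inr, eval_C]
      · simp only [σa, E₁, eval₂Hom_X', Sum.elim_inr, RingHom.comp_apply, RingEquiv.toRingHom_eq_coe,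
          AlgEquiv.toRingEquiv_toRingHom, RingHom.coe_coe, AlgEquiv.trans_apply, renameEquiv_apply, rename_X,
          Equiv.sumComm_apply, Sum.swap_inr, sumAlgEquiv_X_inl, eval_X, map_natCast]
  set E := 𝒬.map σa with hE
  have hE0 : E ≠ 0 := by
    intro h0
    have h1 : σa (𝒬.coeff k₀) = 0 := by
      have := congrArg (fun p => p.coeff k₀) h0
      simpa only [hE, Polynomial.coeff_map, Polynomial.coeff_zero] using this
    rw [hσa, RingHom.comp_apply] at h1
    exact ha h1
  -- the identity `E(T̄, ξ_{j₀}) = 0`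
  set Ψ : MvPolynomial ι ℤ →+* MvPolynomial (Fin n × Fin t) F₀ :=
    eval₂Hom (Int.castRingHom _) (Sum.elim (fun k => C (φ (C (X k)))) (fun p => X p)) with hΨ
  set eva : MvPolynomial (Fin n × Fin t) F₀ →+* F₀ := eval fun p => ((a p : ℕ) : F₀) with heva
  have hcomp : eva.comp Ψ = θ.comp σa := by
    refine MvPolynomial.ringHom_ext (fun z => ?_) (fun v => ?_)
    · simp only [eq_intCast, map_intCast]
    · rcases v with k | p
      · simp only [hΨ, heva, σa, hθ, RingHom.comp_apply, eval₂Hom_X', Sum.elim_inl, eval_C]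
      · simp only [hΨ, heva, σa, RingHom.comp_apply, eval₂Hom_X', Sum.elim_inr, eval_X, map_natCast]
  have hidE : (E.map θ).eval (φ (X j₀)) = 0 := by
    have h := congrArg eva hid
    rw [map_zero, Polynomial.eval_map, Polynomial.hom_eval₂, hcomp, ← Polynomial.eval₂_map,
      ← Polynomial.eval_map, Polynomial.map_map] at h
    rw [hE, Polynomial.map_map]
    have hpt : eva (C (φ (X j₀))) = φ (X j₀) := by rw [heva, eval_C]
    rw [hpt] at h
    exact h
  -- sizes of `E`
  have hσadeg : ∀ g : MvPolynomial ι ℤ, (σa g).totalDegree ≤ g.totalDegree := by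
    intro g
    have : σa g = aeval (Sum.elim (fun k => X k) (fun p => C ((a p : ℕ) : ℤ)) : ι → MvPolynomial (Fin r) ℤ) g := by
      rw [MvPolynomial.aeval_def]
      rfl
    rw [this]
    refine (totalDegree_aeval_le_mul _ (e := 1) (fun v => ?_) g).trans (by rw [one_mul])
    rcases v with k | p
    · simp only [Sum.elim_inl, totalDegree_X]; exact le_rfl
    · simp only [Sum.elim_inr, totalDegree_C]; exact Nat.zero_le _
  refine ⟨E, hE0, hidE, ?_, fun i => ?_⟩
  · rw [hE]; exact (Polynomial.natDegree_map_le).trans h𝒬deg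
  · rw [hE, Polynomial.coeff_map]
    exact (hσadeg _).trans (h𝒬coeff i)

end Summit.ValiantsHypothesis.ValiantsHypothesis.Theorems.LangWeilTransfer
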